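import Literature.MathematicalPhysics.QuantumLattice.InfVolFermionState
import Literature.MathematicalPhysics.QuantumLattice.FockGaugeRotation
import Literature.LinearAlgebra.Matrix.GradedCompression
import HarnessLib

/-!
# The `U(1)` gauge action on fermionic Fock space: `γ_θ(c) = e^{-iθ} c`, charges, and the
# conditional expectation onto the gauge-invariant (particle-number block-diagonal) algebra

Topic `Literature/MathematicalPhysics/QuantumLattice` (namespace = path). Seat `hubbard-cq-p4` (cell
`pub/hubbard-cq`; the «gauge action on infinite-volume states» recorded as NOT in the tree by
`DWaveOrderParameterSymmetricRange.lean`). Finite matrices only; everything is PROVED, no named fact.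

The global gauge (particle-number) symmetry of the CAR algebra, `α_θ(a(f)) = a(e^{iθ} f)`
(Bratteli–Robinson II §5.2.2), is implemented on the Fock space over the orbitals `κ` by the unitary
`e^{iθN̂} = diagonal (s ↦ e^{iθ|s|})` (Tasaki 2020 §9.2). The tree so far held its QUARTER-TURN powers
(`fockGauge k = i^{kN̂}`, `FockGaugeRotation.lean`) and the parity `Θ = (-1)^{N̂}` (`parityAut`); this
file types the full one-parameter group and its standard consequences:

* `fockGaugeU1 θ = e^{iθN̂}` (`= diagonal (s ↦ exp (iθ|s|))`): group law, unitarity, adjoint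
  `= fockGaugeU1 (-θ)`; `fockGaugeU1 (k·π/2) = fockGauge k` (extends the discrete gauge rotation).
* `gaugeAut θ : Matrix →ₐ[ℂ] Matrix`, `γ_θ(a) = e^{iθN̂} a e^{-iθN̂}`, with the ENTRY FORMULA
  `(γ_θ a) s t = e^{iθ(|s|−|t|)} a s t` (`gaugeAut_apply_apply`); `γ_θ(c_j) = e^{-iθ} c_j`,
  `γ_θ(c†_j) = e^{iθ} c†_j`, `γ_θ(n_j) = n_j`; `γ_0 = id`, `γ_θ ∘ γ_φ = γ_{θ+φ}`, `*`-preservation,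
  `γ_π = Θ` (`gaugeAut_pi`, so the gauge group contains the parity and commutes with it); and
  **`fermionEmbed_gaugeAut`**: the second quantisation `Γ(φ)` of every injection of sites commutes
  with the gauge action (both are algebra homomorphisms with `c ↦ e^{-iθ} c'`; `algHom_ext_car`).
* CHARGES: `HasGaugeCharge q a :↔ ∀ θ, γ_θ a = e^{iqθ} a` (`q : ℤ`), with the Fock-space
  characterisation `hasGaugeCharge_iff` (`a s t = 0` unless `|s| − |t| = q`), closure under
  `+`, `•`, `Σ`, `*` (charges add), `ᴴ` (charge flips), `Γ(φ)` (charge preserved), and the charges of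
  the generators (`c† : +1`, `c : −1`, matrix units `|s⟩⟨t| : |s| − |t|`).
* THE CONDITIONAL EXPECTATION onto the gauge-invariant algebra is the tree's graded compression
  (pinching) by particle number, `gradedCompress Finset.card` (`Literature.LinearAlgebra.Matrix`,
  `E(a) s t = [|s| = |t|] a s t = Σ_n P_n a P_n`; positivity / bimodule / trace facts live there):
  here `gaugeAut_gradedCompress` / `gradedCompress_gaugeAut` (`γ_θ ∘ E = E = E ∘ γ_θ`),
  `gradedCompress_of_hasGaugeCharge` (`E a = [q = 0] a` on charge-`q` elements),
  `gradedCompress_eq_self_iff_forall_gaugeAut` (the gauge-INVARIANT elements are exactly the fixed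
  points of `E`), and **`fermionEmbed_gradedCompress`** (`Γ(φ) ∘ E = E ∘ Γ(φ)`: the expectations are
  compatible with isotony and translations — what makes the gauge AVERAGE of an infinite-volume
  state a state, sequel file `InfVolFermionStateGaugeAction.lean`).

## References
* O. Bratteli, D. W. Robinson, *Operator Algebras and Quantum Statistical Mechanics 2*, 2nd ed. (1997),
  §5.2.2 (gauge group of the CAR algebra; gauge-invariant quasi-free states). [cite: BratteliRobinsonII1997, §5.2.2]
* H. Tasaki, *Physics and Mathematics of Quantum Many-Body Systems* (2020), §9.2 (number operator on
  Fock space, `U(1)` symmetry). [cite: Tasaki2020, §9.2]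
* D. Petz, *Quantum Information Theory and Quantum Statistics* (2008), §9.2 (conditional expectations;
  the group average onto the fixed-point algebra). [cite: Petz2008, §9.2]
-/

noncomputable section

open Matrix Finset Complex Literature.LinearAlgebra.Matrix

namespace Literature.MathematicalPhysics.QuantumLattice

variable {κ : Type*} [LinearOrder κ] [Fintype κ]

/-! ## The gauge unitaries `e^{iθN̂}` -/

/-- **The `U(1)` gauge unitary `e^{iθN̂} = diagonal (s ↦ e^{iθ|s|})`** on fermionic Fock space over the
orbitals `κ` (`|s⟩` the occupation-number basis). [cite: BratteliRobinsonII1997, §5.2.2] -/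
def fockGaugeU1 (θ : ℝ) : Matrix (Finset κ) (Finset κ) ℂ :=
  diagonal fun s => exp (I * θ * s.card)

omit [Fintype κ] in
/-- Entries of `e^{iθN̂}`. [cite: BratteliRobinsonII1997, §5.2.2] -/
theorem fockGaugeU1_apply (θ : ℝ) (s t : Finset κ) :
    fockGaugeU1 θ s t = if s = t then exp (I * θ * s.card) else 0 := by
  rw [fockGaugeU1, diagonal_apply]

omit [Fintype κ] in
/-- `e^{i·0·N̂} = 1`. [cite: BratteliRobinsonII1997, §5.2.2] -/
@[simp] theorem fockGaugeU1_zero : (fockGaugeU1 0 : Matrix (Finset κ) (Finset κ) ℂ) = 1 := by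
  rw [fockGaugeU1, ← diagonal_one]
  congr 1
  funext s
  simp

/-- **Group law** `e^{iθN̂} e^{iφN̂} = e^{i(θ+φ)N̂}`. [cite: BratteliRobinsonII1997, §5.2.2] -/
theorem fockGaugeU1_mul (θ φ : ℝ) :
    (fockGaugeU1 θ : Matrix (Finset κ) (Finset κ) ℂ) * fockGaugeU1 φ = fockGaugeU1 (θ + φ) := by
  rw [fockGaugeU1, fockGaugeU1, diagonal_mul_diagonal, fockGaugeU1]
  congr 1
  funext s
  rw [← Complex.exp_add]
  congr 1
  push_cast
  ring

omit [Fintype κ] in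
/-- **Adjoint** `(e^{iθN̂})ᴴ = e^{-iθN̂}`. [cite: BratteliRobinsonII1997, §5.2.2] -/
theorem conjTranspose_fockGaugeU1 (θ : ℝ) :
    (fockGaugeU1 θ : Matrix (Finset κ) (Finset κ) ℂ)ᴴ = fockGaugeU1 (-θ) := by
  rw [fockGaugeU1, diagonal_conjTranspose, fockGaugeU1]
  congr 1
  funext s
  rw [Pi.star_apply, Complex.star_def, ← Complex.exp_conj]
  congr 1
  simp only [map_mul, Complex.conj_I, Complex.conj_ofReal, map_natCast, Complex.ofReal_neg]
  ring

/-- Unitarity `e^{iθN̂} (e^{iθN̂})ᴴ = 1`. [cite: BratteliRobinsonII1997, §5.2.2] -/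
theorem fockGaugeU1_mul_conjTranspose_self (θ : ℝ) :
    (fockGaugeU1 θ : Matrix (Finset κ) (Finset κ) ℂ) * (fockGaugeU1 θ)ᴴ = 1 := by
  rw [conjTranspose_fockGaugeU1, fockGaugeU1_mul, add_neg_cancel, fockGaugeU1_zero]

/-- Unitarity `(e^{iθN̂})ᴴ e^{iθN̂} = 1`. [cite: BratteliRobinsonII1997, §5.2.2] -/
theorem fockGaugeU1_conjTranspose_mul_self (θ : ℝ) :
    (fockGaugeU1 θ : Matrix (Finset κ) (Finset κ) ℂ)ᴴ * fockGaugeU1 θ = 1 := by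
  rw [conjTranspose_fockGaugeU1, fockGaugeU1_mul, neg_add_cancel, fockGaugeU1_zero]

omit [Fintype κ] in
/-- **The quarter turns are the tree's discrete gauge rotation**: `e^{i(kπ/2)N̂} = fockGauge k = i^{kN̂}`.
[cite: BratteliRobinsonII1997, §5.2.2] -/
theorem fockGaugeU1_mul_pi_div_two (k : ℕ) :
    (fockGaugeU1 (k * (Real.pi / 2)) : Matrix (Finset κ) (Finset κ) ℂ) = fockGauge k := by
  rw [fockGaugeU1, fockGauge]
  congr 1
  funext s
  conv_rhs => rw [← Complex.exp_pi_div_two_mul_I, ← Complex.exp_nat_mul]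
  congr 1
  push_cast
  ring

/-! ## The gauge automorphisms `γ_θ` -/

/-- **The gauge automorphism `γ_θ(a) = e^{iθN̂} a e^{-iθN̂}`** of the CAR algebra of the finite orbital
set `κ` (as an algebra homomorphism of the Fock-space matrix algebra; `γ_θ(c_j) = e^{-iθ} c_j`).
[cite: BratteliRobinsonII1997, §5.2.2] -/
def gaugeAut (θ : ℝ) : Matrix (Finset κ) (Finset κ) ℂ →ₐ[ℂ] Matrix (Finset κ) (Finset κ) ℂ where
  toFun b := fockGaugeU1 θ * b * (fockGaugeU1 θ)ᴴ
  map_one' := by rw [Matrix.mul_one, fockGaugeU1_mul_conjTranspose_self]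
  map_mul' b c := by
    calc fockGaugeU1 θ * (b * c) * (fockGaugeU1 θ)ᴴ
        = fockGaugeU1 θ * b * ((fockGaugeU1 θ)ᴴ * fockGaugeU1 θ) * c * (fockGaugeU1 θ)ᴴ := by
          rw [fockGaugeU1_conjTranspose_mul_self, Matrix.mul_one, Matrix.mul_assoc (fockGaugeU1 θ) b c]
      _ = fockGaugeU1 θ * b * (fockGaugeU1 θ)ᴴ * (fockGaugeU1 θ * c * (fockGaugeU1 θ)ᴴ) := by
          simp only [Matrix.mul_assoc]
  map_zero' := by rw [Matrix.mul_zero, Matrix.zero_mul]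
  map_add' b c := by rw [Matrix.mul_add, Matrix.add_mul]
  commutes' c := by
    rw [Algebra.algebraMap_eq_smul_one, Matrix.mul_smul, Matrix.mul_one, Matrix.smul_mul,
      fockGaugeU1_mul_conjTranspose_self]

/-- `γ_θ(a) = e^{iθN̂} a (e^{iθN̂})ᴴ` (definitional). [cite: BratteliRobinsonII1997, §5.2.2] -/
theorem gaugeAut_apply (θ : ℝ) (b : Matrix (Finset κ) (Finset κ) ℂ) :
    gaugeAut θ b = fockGaugeU1 θ * b * (fockGaugeU1 θ)ᴴ :=
  rfl

/-- **ENTRY FORMULA**: `(γ_θ a) s t = e^{iθ(|s| − |t|)} · a s t` — the gauge action multiplies the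
matrix unit `|s⟩⟨t|` by the phase of its charge `|s| − |t|`. [cite: Tasaki2020, §9.2] -/
theorem gaugeAut_apply_apply (θ : ℝ) (a : Matrix (Finset κ) (Finset κ) ℂ) (s t : Finset κ) :
    gaugeAut θ a s t = exp (I * θ * (((s.card : ℤ) - (t.card : ℤ) : ℤ) : ℂ)) * a s t := by
  rw [gaugeAut_apply, conjTranspose_fockGaugeU1, fockGaugeU1, fockGaugeU1, mul_diagonal, diagonal_mul,
    mul_right_comm, ← Complex.exp_add]
  congr 2
  push_cast
  ring

/-- `γ_0 = id`. [cite: BratteliRobinsonII1997, §5.2.2] -/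
theorem gaugeAut_zero : (gaugeAut 0 : Matrix (Finset κ) (Finset κ) ℂ →ₐ[ℂ] _) = AlgHom.id ℂ _ := by
  ext b : 1
  rw [gaugeAut_apply, fockGaugeU1_zero, conjTranspose_one, Matrix.one_mul, Matrix.mul_one, AlgHom.id_apply]

/-- `γ_0 a = a`. [cite: BratteliRobinsonII1997, §5.2.2] -/
@[simp] theorem gaugeAut_zero_apply (a : Matrix (Finset κ) (Finset κ) ℂ) : gaugeAut 0 a = a := by
  rw [gaugeAut_zero, AlgHom.id_apply]

/-- **Group law** `γ_θ (γ_φ a) = γ_{θ+φ} a`. [cite: BratteliRobinsonII1997, §5.2.2] -/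
theorem gaugeAut_gaugeAut (θ φ : ℝ) (a : Matrix (Finset κ) (Finset κ) ℂ) :
    gaugeAut θ (gaugeAut φ a) = gaugeAut (θ + φ) a := by
  ext s t
  rw [gaugeAut_apply_apply, gaugeAut_apply_apply, gaugeAut_apply_apply, ← mul_assoc, ← Complex.exp_add]
  congr 2
  push_cast
  ring

/-- The gauge automorphisms commute. [cite: BratteliRobinsonII1997, §5.2.2] -/
theorem gaugeAut_comm (θ φ : ℝ) (a : Matrix (Finset κ) (Finset κ) ℂ) :
    gaugeAut θ (gaugeAut φ a) = gaugeAut φ (gaugeAut θ a) := by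
  rw [gaugeAut_gaugeAut, gaugeAut_gaugeAut, add_comm]

/-- `γ_{-θ} (γ_θ a) = a`. [cite: BratteliRobinsonII1997, §5.2.2] -/
@[simp] theorem gaugeAut_neg_gaugeAut (θ : ℝ) (a : Matrix (Finset κ) (Finset κ) ℂ) :
    gaugeAut (-θ) (gaugeAut θ a) = a := by
  rw [gaugeAut_gaugeAut, neg_add_cancel, gaugeAut_zero_apply]

/-- **`γ_θ` is a `*`-map**: `γ_θ(aᴴ) = (γ_θ a)ᴴ`. [cite: BratteliRobinsonII1997, §5.2.2] -/
theorem gaugeAut_conjTranspose (θ : ℝ) (a : Matrix (Finset κ) (Finset κ) ℂ) :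
    gaugeAut θ aᴴ = (gaugeAut θ a)ᴴ := by
  rw [gaugeAut_apply, gaugeAut_apply, conjTranspose_mul, conjTranspose_mul, conjTranspose_conjTranspose,
    Matrix.mul_assoc]

/-- `γ_θ(aᴴ a) = (γ_θ a)ᴴ (γ_θ a)` (positivity is preserved). [cite: BratteliRobinsonII1997, §5.2.2] -/
theorem gaugeAut_conjTranspose_mul_self (θ : ℝ) (a : Matrix (Finset κ) (Finset κ) ℂ) :
    gaugeAut θ (aᴴ * a) = (gaugeAut θ a)ᴴ * gaugeAut θ a := by
  rw [map_mul, gaugeAut_conjTranspose]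

/-- Periodicity: `γ_{θ + 2π} = γ_θ` (all charges are integers). [cite: BratteliRobinsonII1997, §5.2.2] -/
theorem gaugeAut_add_two_pi (θ : ℝ) (a : Matrix (Finset κ) (Finset κ) ℂ) :
    gaugeAut (θ + 2 * Real.pi) a = gaugeAut θ a := by
  ext s t
  rw [gaugeAut_apply_apply, gaugeAut_apply_apply]
  congr 1
  have h : I * ((θ + 2 * Real.pi : ℝ) : ℂ) * (((s.card : ℤ) - (t.card : ℤ) : ℤ) : ℂ) =
      I * θ * (((s.card : ℤ) - (t.card : ℤ) : ℤ) : ℂ) +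
        (((s.card : ℤ) - (t.card : ℤ) : ℤ) : ℂ) * (2 * Real.pi * I) := by
    push_cast; ring
  rw [h, Complex.exp_add, Complex.exp_int_mul_two_pi_mul_I, mul_one]

/-! ## Action on the generators; `γ_π = Θ` -/

/-- **`γ_θ(c_j) = e^{-iθ} c_j`** (an annihilator lowers the particle number by one).
[cite: BratteliRobinsonII1997, §5.2.2] -/
@[simp] theorem gaugeAut_annihilation (θ : ℝ) (j : κ) :
    gaugeAut θ (annihilation j) = exp (-(I * θ)) • annihilation j := by
  ext s t
  rw [gaugeAut_apply_apply, Matrix.smul_apply, smul_eq_mul, annihilation_apply]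
  split_ifs with h
  · rw [h.2, card_insert_of_notMem h.1]
    congr 1
    congr 1
    push_cast
    ring
  · rw [mul_zero, mul_zero]

/-- **`γ_θ(c†_j) = e^{iθ} c†_j`** (a creator raises the particle number by one).
[cite: BratteliRobinsonII1997, §5.2.2] -/
@[simp] theorem gaugeAut_creation (θ : ℝ) (j : κ) :
    gaugeAut θ (creation j) = exp (I * θ) • creation j := by
  ext s t
  rw [gaugeAut_apply_apply, Matrix.smul_apply, smul_eq_mul, creation_apply]
  split_ifs with h
  · rw [h.2, card_insert_of_notMem h.1]
    congr 1
    congr 1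
    push_cast
    ring
  · rw [mul_zero, mul_zero]

/-- `γ_θ(c†_i c_j) = c†_i c_j`: hopping / number words are gauge invariant. [cite: BratteliRobinsonII1997, §5.2.2] -/
@[simp] theorem gaugeAut_creation_mul_annihilation (θ : ℝ) (i j : κ) :
    gaugeAut θ (creation i * annihilation j) = creation i * annihilation j := by
  rw [map_mul, gaugeAut_creation, gaugeAut_annihilation, Matrix.smul_mul, Matrix.mul_smul, smul_smul,
    ← Complex.exp_add, add_neg_cancel, Complex.exp_zero, one_smul]

/-- `γ_θ(c_i c_j) = e^{-2iθ} c_i c_j`: a pair annihilator has charge `−2`. [cite: BratteliRobinsonII1997, §5.2.2] -/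
theorem gaugeAut_annihilation_mul_annihilation (θ : ℝ) (i j : κ) :
    gaugeAut θ (annihilation i * annihilation j) = exp (-(2 * (I * θ))) • (annihilation i * annihilation j) := by
  rw [map_mul, gaugeAut_annihilation, gaugeAut_annihilation, Matrix.smul_mul, Matrix.mul_smul, smul_smul,
    ← Complex.exp_add]
  congr 1
  ring_nf

/-- `γ_θ(n_j) = n_j` for the occupation numbers `numberAt`. [cite: Tasaki2020, §9.2] -/
@[simp] theorem gaugeAut_numberAt (θ : ℝ) (j : κ) : gaugeAut θ (numberAt j) = numberAt j :=
  gaugeAut_creation_mul_annihilation θ j j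

/-- **`γ_π = Θ`**: the gauge half-turn is the even–odd automorphism `parityAut` (`e^{iπ} = −1`), so
the parity lies in the gauge group (and commutes with every `γ_θ`, `gaugeAut_comm`).
[cite: BratteliRobinsonII1997, §5.2.2] -/
theorem gaugeAut_pi : (gaugeAut Real.pi : Matrix (Finset κ) (Finset κ) ℂ →ₐ[ℂ] _) = parityAut := by
  refine algHom_ext_car (fun i => ?_) (fun i => ?_)
  · rw [gaugeAut_annihilation, parityAut_annihilation, mul_comm I, Complex.exp_neg, Complex.exp_pi_mul_I]
    norm_num
  · rw [gaugeAut_creation, parityAut_creation, mul_comm I, Complex.exp_pi_mul_I, neg_one_smul]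

/-- `γ_θ` commutes with the even–odd automorphism. [cite: BratteliRobinsonII1997, §5.2.2] -/
theorem gaugeAut_parityAut (θ : ℝ) (a : Matrix (Finset κ) (Finset κ) ℂ) :
    gaugeAut θ (parityAut a) = parityAut (gaugeAut θ a) := by
  rw [← gaugeAut_pi, gaugeAut_comm]

/-! ## `Γ(φ)` commutes with the gauge action -/

section FermionEmbed

variable {Λ Λ' : Type*} [LinearOrder Λ] [Fintype Λ] [LinearOrder Λ'] [Fintype Λ']

/-- **The second quantisation `Γ(φ)` of an injection of sites commutes with the gauge action**:
`Γ(φ) ∘ γ_θ = γ_θ ∘ Γ(φ)` (both composites are algebra homomorphisms with `c_{xσ} ↦ e^{-iθ} c_{φx,σ}`,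
`c† ↦ e^{iθ} c'†`; uniqueness `algHom_ext_car`). [cite: BratteliRobinsonII1997, §5.2.2] -/
theorem fermionEmbed_comp_gaugeAut (φ : Λ ↪ Λ') (θ : ℝ) :
    (fermionEmbed φ).comp (gaugeAut (κ := Orb Λ) θ) = (gaugeAut (κ := Orb Λ') θ).comp (fermionEmbed φ) := by
  refine algHom_ext_car (fun i => ?_) (fun i => ?_)
  · rw [AlgHom.comp_apply, AlgHom.comp_apply, gaugeAut_annihilation, map_smul, fermionEmbed_annihilation',
      gaugeAut_annihilation]
  · rw [AlgHom.comp_apply, AlgHom.comp_apply, gaugeAut_creation, map_smul, fermionEmbed_creation',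
      gaugeAut_creation]

/-- `Γ(φ) (γ_θ a) = γ_θ (Γ(φ) a)`, applied form. [cite: BratteliRobinsonII1997, §5.2.2] -/
theorem fermionEmbed_gaugeAut (φ : Λ ↪ Λ') (θ : ℝ) (a : Matrix (Finset (Orb Λ)) (Finset (Orb Λ)) ℂ) :
    fermionEmbed φ (gaugeAut θ a) = gaugeAut θ (fermionEmbed φ a) := by
  rw [← AlgHom.comp_apply, fermionEmbed_comp_gaugeAut, AlgHom.comp_apply]

end FermionEmbed

/-! ## Charges -/

/-- **`a` has gauge charge `q ∈ ℤ`**: `γ_θ(a) = e^{iqθ} a` for all `θ` (creators `+1`, annihilators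
`−1`; a `d`-wave pair annihilator `−2`; Hamiltonian terms `0`). [cite: BratteliRobinsonII1997, §5.2.2] -/
def HasGaugeCharge (q : ℤ) (a : Matrix (Finset κ) (Finset κ) ℂ) : Prop :=
  ∀ θ : ℝ, gaugeAut θ a = exp (I * θ * q) • a

omit [LinearOrder κ] [Fintype κ] in
/-- Phases separate integers: if `e^{iθn} = e^{iθq}` for all real `θ` then `n = q`. [folklore] -/
private theorem int_eq_of_forall_exp_mul_eq {n q : ℤ} (h : ∀ θ : ℝ, exp (I * θ * n) = exp (I * θ * q)) : n = q := by
  by_contra hne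
  have hm : ((n - q : ℤ) : ℝ) ≠ 0 := by exact_mod_cast sub_ne_zero.2 hne
  set θ : ℝ := Real.pi / ((n - q : ℤ) : ℝ) with hθ
  have h1 : exp (I * θ * n - I * θ * q) = 1 := by
    rw [Complex.exp_sub, h θ, div_self (Complex.exp_ne_zero _)]
  have h2 : I * (θ : ℂ) * n - I * θ * q = Real.pi * I := by
    have : (θ : ℂ) * (((n - q : ℤ) : ℝ) : ℂ) = Real.pi := by
      rw [hθ]; push_cast
      rw [div_mul_cancel₀]
      exact_mod_cast hm
    calc I * (θ : ℂ) * n - I * θ * q = I * (θ * (((n - q : ℤ) : ℝ) : ℂ)) := by push_cast; ring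
      _ = Real.pi * I := by rw [this, mul_comm]
  rw [h2, Complex.exp_pi_mul_I] at h1
  norm_num at h1

/-- **Fock-space characterisation of charge**: `a` has charge `q` iff its entries vanish outside the
pairs of configurations with `|s| − |t| = q`. [cite: Tasaki2020, §9.2] -/
theorem hasGaugeCharge_iff {q : ℤ} {a : Matrix (Finset κ) (Finset κ) ℂ} :
    HasGaugeCharge q a ↔ ∀ s t : Finset κ, (s.card : ℤ) - t.card ≠ q → a s t = 0 := by
  constructor
  · intro h s t hst
    by_contra hne
    apply hst
    refine int_eq_of_forall_exp_mul_eq fun θ => ?_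
    have hθ := congrFun (congrFun (h θ) s) t
    rw [gaugeAut_apply_apply, Matrix.smul_apply, smul_eq_mul] at hθ
    exact mul_right_cancel₀ hne hθ
  · intro h θ
    ext s t
    rw [gaugeAut_apply_apply, Matrix.smul_apply, smul_eq_mul]
    by_cases hst : (s.card : ℤ) - t.card = q
    · rw [hst]
    · rw [h s t hst, mul_zero, mul_zero]

namespace HasGaugeCharge

/-- `0` has every charge. [cite: BratteliRobinsonII1997, §5.2.2] -/
theorem zero (q : ℤ) : HasGaugeCharge q (0 : Matrix (Finset κ) (Finset κ) ℂ) := fun _ => by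
  rw [map_zero, smul_zero]

/-- Sums of charge-`q` elements have charge `q`. [cite: BratteliRobinsonII1997, §5.2.2] -/
theorem add {q : ℤ} {a b : Matrix (Finset κ) (Finset κ) ℂ} (ha : HasGaugeCharge q a)
    (hb : HasGaugeCharge q b) : HasGaugeCharge q (a + b) := fun θ => by
  rw [map_add, ha θ, hb θ, smul_add]

/-- Differences. [cite: BratteliRobinsonII1997, §5.2.2] -/
theorem sub {q : ℤ} {a b : Matrix (Finset κ) (Finset κ) ℂ} (ha : HasGaugeCharge q a)
    (hb : HasGaugeCharge q b) : HasGaugeCharge q (a - b) := fun θ => by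
  rw [map_sub, ha θ, hb θ, smul_sub]

/-- Negation. [cite: BratteliRobinsonII1997, §5.2.2] -/
theorem neg {q : ℤ} {a : Matrix (Finset κ) (Finset κ) ℂ} (ha : HasGaugeCharge q a) :
    HasGaugeCharge q (-a) := fun θ => by
  rw [map_neg, ha θ, smul_neg]

/-- Scalar multiples. [cite: BratteliRobinsonII1997, §5.2.2] -/
theorem smul {q : ℤ} {a : Matrix (Finset κ) (Finset κ) ℂ} (ha : HasGaugeCharge q a) (c : ℂ) :
    HasGaugeCharge q (c • a) := fun θ => by
  rw [map_smul, ha θ, smul_comm]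

/-- Finite sums. [cite: BratteliRobinsonII1997, §5.2.2] -/
theorem sum {q : ℤ} {β : Type*} (S : Finset β) {f : β → Matrix (Finset κ) (Finset κ) ℂ}
    (hf : ∀ b ∈ S, HasGaugeCharge q (f b)) : HasGaugeCharge q (∑ b ∈ S, f b) := fun θ => by
  rw [map_sum, Finset.smul_sum]
  exact Finset.sum_congr rfl fun b hb => hf b hb θ

/-- **Charges add under products.** [cite: BratteliRobinsonII1997, §5.2.2] -/
theorem mul {p q : ℤ} {a b : Matrix (Finset κ) (Finset κ) ℂ} (ha : HasGaugeCharge p a)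
    (hb : HasGaugeCharge q b) : HasGaugeCharge (p + q) (a * b) := fun θ => by
  rw [map_mul, ha θ, hb θ, Matrix.smul_mul, Matrix.mul_smul, smul_smul, ← Complex.exp_add]
  congr 1
  push_cast
  ring_nf

/-- **The adjoint flips the charge.** [cite: BratteliRobinsonII1997, §5.2.2] -/
theorem conjTranspose {q : ℤ} {a : Matrix (Finset κ) (Finset κ) ℂ} (ha : HasGaugeCharge q a) :
    HasGaugeCharge (-q) aᴴ := fun θ => by
  rw [gaugeAut_conjTranspose, ha θ, conjTranspose_smul, Complex.star_def, ← Complex.exp_conj]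
  congr 1
  congr 1
  simp only [map_mul, Complex.conj_I, Complex.conj_ofReal, map_intCast]
  push_cast
  ring

/-- A gauge-invariant (`q = 0`) element is fixed by every `γ_θ`. [cite: BratteliRobinsonII1997, §5.2.2] -/
theorem gaugeAut_eq {a : Matrix (Finset κ) (Finset κ) ℂ} (ha : HasGaugeCharge 0 a) (θ : ℝ) :
    gaugeAut θ a = a := by
  rw [ha θ, Int.cast_zero, mul_zero, Complex.exp_zero, one_smul]

end HasGaugeCharge

/-- Charge `0` is gauge INVARIANCE: `HasGaugeCharge 0 a ↔ ∀ θ, γ_θ a = a`. [cite: BratteliRobinsonII1997, §5.2.2] -/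
theorem hasGaugeCharge_zero_iff {a : Matrix (Finset κ) (Finset κ) ℂ} :
    HasGaugeCharge 0 a ↔ ∀ θ : ℝ, gaugeAut θ a = a := by
  refine ⟨fun h θ => h.gaugeAut_eq θ, fun h θ => ?_⟩
  rw [h θ, Int.cast_zero, mul_zero, Complex.exp_zero, one_smul]

/-- `1` is gauge invariant. [cite: BratteliRobinsonII1997, §5.2.2] -/
theorem HasGaugeCharge.one : HasGaugeCharge 0 (1 : Matrix (Finset κ) (Finset κ) ℂ) :=
  hasGaugeCharge_zero_iff.2 fun _ => map_one _

/-- `c†_j` has charge `+1`. [cite: BratteliRobinsonII1997, §5.2.2] -/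
theorem hasGaugeCharge_creation (j : κ) : HasGaugeCharge 1 (creation j) := fun θ => by
  rw [gaugeAut_creation, Int.cast_one, mul_one]

/-- `c_j` has charge `−1`. [cite: BratteliRobinsonII1997, §5.2.2] -/
theorem hasGaugeCharge_annihilation (j : κ) : HasGaugeCharge (-1) (annihilation j) := fun θ => by
  rw [gaugeAut_annihilation, Int.cast_neg, Int.cast_one, mul_neg, mul_one]

/-- `c†_i c_j` has charge `0`. [cite: BratteliRobinsonII1997, §5.2.2] -/
theorem hasGaugeCharge_creation_mul_annihilation (i j : κ) :
    HasGaugeCharge 0 (creation i * annihilation j) :=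
  hasGaugeCharge_zero_iff.2 fun θ => gaugeAut_creation_mul_annihilation θ i j

/-- `c_i c_j` has charge `−2`. [cite: BratteliRobinsonII1997, §5.2.2] -/
theorem hasGaugeCharge_annihilation_mul_annihilation (i j : κ) :
    HasGaugeCharge (-2) (annihilation i * annihilation j) := by
  have h := (hasGaugeCharge_annihilation i).mul (hasGaugeCharge_annihilation j)
  norm_num at h
  exact h

/-- **The matrix unit `|s⟩⟨t|` has charge `|s| − |t|`.** [cite: Tasaki2020, §9.2] -/
theorem hasGaugeCharge_single (s t : Finset κ) (c : ℂ) :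
    HasGaugeCharge ((s.card : ℤ) - t.card) (Matrix.single s t c) := by
  refine hasGaugeCharge_iff.2 fun u v huv => ?_
  rw [Matrix.single_apply, if_neg]
  rintro ⟨rfl, rfl⟩
  exact huv rfl

section FermionEmbedCharge

variable {Λ Λ' : Type*} [LinearOrder Λ] [Fintype Λ] [LinearOrder Λ'] [Fintype Λ']

/-- **`Γ(φ)` preserves charges.** [cite: BratteliRobinsonII1997, §5.2.2] -/
theorem HasGaugeCharge.fermionEmbed (φ : Λ ↪ Λ') {q : ℤ} {a : Matrix (Finset (Orb Λ)) (Finset (Orb Λ)) ℂ}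
    (ha : HasGaugeCharge q a) : HasGaugeCharge q (fermionEmbed φ a) := fun θ => by
  rw [← fermionEmbed_gaugeAut, ha θ, map_smul]

end FermionEmbedCharge

/-! ## The conditional expectation onto the gauge-invariant algebra: pinching by particle number -/

omit [LinearOrder κ] [Fintype κ] in
/-- Entries of the particle-number pinching `E = gradedCompress Finset.card`:
`(E a) s t = [|s| = |t|] · a s t`. [cite: Petz2008, §9.2] -/
theorem gradedCompress_card_apply (a : Matrix (Finset κ) (Finset κ) ℂ) (s t : Finset κ) :
    gradedCompress Finset.card a s t = if s.card = t.card then a s t else 0 :=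
  gradedCompress_apply _ _ _ _

/-- **`E a` is gauge invariant**: `γ_θ (E a) = E a`. [cite: Petz2008, §9.2] -/
theorem gaugeAut_gradedCompress (θ : ℝ) (a : Matrix (Finset κ) (Finset κ) ℂ) :
    gaugeAut θ (gradedCompress Finset.card a) = gradedCompress Finset.card a := by
  ext s t
  rw [gaugeAut_apply_apply, gradedCompress_card_apply]
  by_cases h : s.card = t.card
  · rw [if_pos h, h, sub_self, Int.cast_zero, mul_zero, Complex.exp_zero, one_mul]
  · rw [if_neg h, mul_zero]

/-- `E a` has charge `0`. [cite: Petz2008, §9.2] -/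
theorem hasGaugeCharge_gradedCompress (a : Matrix (Finset κ) (Finset κ) ℂ) :
    HasGaugeCharge 0 (gradedCompress Finset.card a) :=
  hasGaugeCharge_zero_iff.2 fun θ => gaugeAut_gradedCompress θ a

/-- **`E ∘ γ_θ = E`**: the pinching only sees the gauge orbit. [cite: Petz2008, §9.2] -/
theorem gradedCompress_gaugeAut (θ : ℝ) (a : Matrix (Finset κ) (Finset κ) ℂ) :
    gradedCompress Finset.card (gaugeAut θ a) = gradedCompress Finset.card a := by
  ext s t
  rw [gradedCompress_card_apply, gradedCompress_card_apply, gaugeAut_apply_apply]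
  by_cases h : s.card = t.card
  · rw [if_pos h, if_pos h, h, sub_self, Int.cast_zero, mul_zero, Complex.exp_zero, one_mul]
  · rw [if_neg h, if_neg h]

/-- **`E` on a charge-`q` element**: `E a = a` if `q = 0` and `E a = 0` otherwise.
[cite: Petz2008, §9.2] -/
theorem gradedCompress_of_hasGaugeCharge {q : ℤ} {a : Matrix (Finset κ) (Finset κ) ℂ}
    (ha : HasGaugeCharge q a) : gradedCompress Finset.card a = if q = 0 then a else 0 := by
  rw [hasGaugeCharge_iff] at ha
  ext s t
  rw [gradedCompress_card_apply]
  by_cases hq : q = 0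
  · rw [if_pos hq]
    by_cases h : s.card = t.card
    · rw [if_pos h]
    · rw [if_neg h, ha s t]
      rw [hq, sub_ne_zero]
      exact_mod_cast h
  · rw [if_neg hq, Matrix.zero_apply]
    by_cases h : s.card = t.card
    · rw [if_pos h, ha s t]
      rw [h, sub_self]
      exact Ne.symm hq
    · rw [if_neg h]

/-- A gauge-invariant element is its own pinching. [cite: Petz2008, §9.2] -/
theorem gradedCompress_of_hasGaugeCharge_zero {a : Matrix (Finset κ) (Finset κ) ℂ}
    (ha : HasGaugeCharge 0 a) : gradedCompress Finset.card a = a := by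
  rw [gradedCompress_of_hasGaugeCharge ha, if_pos rfl]

/-- An element of non-zero charge has zero pinching. [cite: Petz2008, §9.2] -/
theorem gradedCompress_of_hasGaugeCharge_ne_zero {q : ℤ} (hq : q ≠ 0) {a : Matrix (Finset κ) (Finset κ) ℂ}
    (ha : HasGaugeCharge q a) : gradedCompress Finset.card a = 0 := by
  rw [gradedCompress_of_hasGaugeCharge ha, if_neg hq]

/-- **The gauge-invariant elements are exactly the fixed points of `E`**:
`E a = a ↔ ∀ θ, γ_θ a = a`. [cite: Petz2008, §9.2] -/
theorem gradedCompress_eq_self_iff_forall_gaugeAut {a : Matrix (Finset κ) (Finset κ) ℂ} :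
    gradedCompress Finset.card a = a ↔ ∀ θ : ℝ, gaugeAut θ a = a := by
  constructor
  · intro h θ
    rw [← h, gaugeAut_gradedCompress]
  · intro h
    exact gradedCompress_of_hasGaugeCharge_zero (hasGaugeCharge_zero_iff.2 h)

omit [LinearOrder κ] [Fintype κ] in
/-- The pinching is additive over finite sums (linearity of the conditional expectation).
[cite: Petz2008, §9.2 eqs. (9.4)–(9.5)] -/
theorem gradedCompress_card_sum {β : Type*} (S : Finset β) (f : β → Matrix (Finset κ) (Finset κ) ℂ) :
    gradedCompress Finset.card (∑ b ∈ S, f b) = ∑ b ∈ S, gradedCompress Finset.card (f b) := by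
  ext s t
  by_cases h : s.card = t.card <;> simp [gradedCompress_apply, Matrix.sum_apply, h]

section FermionEmbedCompress

variable {Λ Λ' : Type*} [LinearOrder Λ] [Fintype Λ] [LinearOrder Λ'] [Fintype Λ']

/-- **`Γ(φ)` commutes with the particle-number pinching**: `Γ(φ) (E a) = E (Γ(φ) a)` — both sides are
linear in `a`, and on a matrix unit `|s⟩⟨t|` (charge `|s| − |t|`, preserved by `Γ(φ)`) both equal
`[|s| = |t|] · Γ(φ)|s⟩⟨t|`. This is what makes the gauge average of a compatible family of local
states compatible (isotony `φ = incl`, translations `φ = τ_v`). [cite: Petz2008, §9.2] -/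
theorem fermionEmbed_gradedCompress (φ : Λ ↪ Λ') (a : Matrix (Finset (Orb Λ)) (Finset (Orb Λ)) ℂ) :
    fermionEmbed φ (gradedCompress Finset.card a) = gradedCompress Finset.card (fermionEmbed φ a) := by
  conv_lhs => rw [Matrix.matrix_eq_sum_single a]
  conv_rhs => rw [Matrix.matrix_eq_sum_single a]
  simp only [gradedCompress_card_sum, map_sum]
  refine Finset.sum_congr rfl fun s _ => Finset.sum_congr rfl fun t _ => ?_
  rw [gradedCompress_of_hasGaugeCharge (hasGaugeCharge_single s t (a s t)),
    gradedCompress_of_hasGaugeCharge ((hasGaugeCharge_single s t (a s t)).fermionEmbed φ)]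
  split_ifs
  · rfl
  · rw [map_zero]

end FermionEmbedCompress

end Literature.MathematicalPhysics.QuantumLattice

end
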